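import Summits.QuantumAdvantage.QuantumAdvantage.Theorems.CharDialTokenDialN
import Summits.QuantumAdvantage.QuantumAdvantage.Theorems.CharDialTokenDialM1
import HarnessLib

/-!
# WalkHardFJLinOdd — the token dial, part P1: the FAR-READER FLIP DIAL (tenth decided dial) and its law

Cell `decomp-qadv`, lens 6, generation 19 (REV4 «FarFlipDial»).  STRATEGY-LEVEL hypothesis `TowerDefs.FarFlipHyp p K w L y`: some
adjacent pair `(s, t = s+1)`, a set `R` of at most `K` cuts outside which the strategy is swap-stable on `{u_s ≠ u_t}`, a tuple of at most
`K` FAR readers whose gap rows are independent of the address row at level `L` (`TokenDial.IndepRows`, part N2 — for ONE far reader: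
its distance from `t` is ≥ `L` and at least `L` positions lie outside the window between them, `indepRows_single`), every cut of `R` that
is not a far reader numbered within `w` of `t`, and `#flipAny ≥ 2ⁿ/(4p)`.  LAWS: `farFlip_bound` (one `n`, explicit smallness
`128·3^K·4^w·p^{K+2}·n^{K+1}·cos(π/(3p))^L ≤ 1`; from part N's `engineFar`) and ★ `farFlip_hard_log`: at the LOG budgets
`K = w = dialB n = 4(log₂ n + 1)` and far threshold `L = (log₂ n)³`, eventually `#WIN_c ≤ (1 − 1/(48p))·2ⁿ` for every residue `c`
(`eventually_smallFar`: every factor is `2^{O(log² n)}`, `cos^{log³ n}` wins).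
-/

set_option autoImplicit false

open Finset

namespace Summit.QuantumAdvantage.AdviceFreeQNC0.JLinPeel

namespace TowerDefs

variable {n : ℕ}

/-- **the FAR-READER FLIP DIAL hypothesis** on a STRATEGY (`K` cuts may react; the far ones through `L`-independent gaps, the others
within `w` of the pair). -/
def FarFlipHyp (p K w L : ℕ) (y : Fin (n + 1) → (Fin n → Bool) → Bool) : Prop :=
  ∃ s t : Fin n, t.val = s.val + 1 ∧ ∃ R : Finset (Fin (n + 1)), R.card ≤ K ∧
    ∃ m : ℕ, m ≤ K ∧ ∃ far : Fin m → Fin (n + 1), TokenDial.IndepRows t far L ∧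
    (∀ g ∈ R, (¬ ∃ k, far k = g) → t.val ≤ g.val + w ∧ g.val ≤ t.val + w) ∧
    (∀ g, g ∉ R → ∀ u : Fin n → Bool, u s ≠ u t → y g (SegMove.segCompl u s.val (s.val + 2)) = y g u) ∧
    2 ^ n ≤ 4 * p * (Finset.univ.filter fun u : Fin n → Bool => u s ≠ u t ∧
      (ringWinU 0 y (SegMove.segCompl u s.val (s.val + 2)) ≠ ringWinU 0 y u ∨
        ringWinU 1 y (SegMove.segCompl u s.val (s.val + 2)) ≠ ringWinU 1 y u ∨
          ringWinU 2 y (SegMove.segCompl u s.val (s.val + 2)) ≠ ringWinU 2 y u)).card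

/-- the FAR THRESHOLD schedule of the log-budget far dial: `(log₂ n)³`. -/
def farL (n : ℕ) : ℕ := Nat.log 2 n ^ 3

end TowerDefs

namespace TokenDial

open SegMove

variable {n : ℕ}

section FarDial

variable {p : ℕ} [hp : Fact p.Prime]

/-! ### §17 one far reader: independence from the geometry -/

omit hp in
/-- **(one far reader).** if the window between cut `g` and position `t` has at least `L` positions and at least `L` positions lie
outside it, the address row and the gap row are independent at level `L`. -/
theorem indepRows_single (t : Fin n) (g : Fin (n + 1)) (L : ℕ)
    (h1 : L ≤ max g.val t.val - min g.val t.val) (h2 : L + (max g.val t.val - min g.val t.val) ≤ n) :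
    IndepRows t (fun _ : Fin 1 => g) L := by
  classical
  have hrowA : ∀ i : Fin n, rowA t.val i ≠ 0 := by
    intro i; unfold rowA; split_ifs <;> decide
  haveI : Fact (Nat.Prime 3) := ⟨Nat.prime_three⟩
  intro μ hμ
  set lo := min g.val t.val with hlo
  set hi := max g.val t.val with hhi
  have hhin : hi ≤ n := by rw [hhi]; exact max_le (by have := g.isLt; omega) t.isLt.le
  have hcomb : ∀ i : Fin n, combW μ (rowsF t (fun _ : Fin 1 => g)) i = μ 0 * rowA t.val i + μ 1 * rowG lo hi i := by
    intro i
    unfold combW rowsF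
    rw [Fin.sum_univ_two]
    rfl
  have hμ01 : μ 0 ≠ 0 ∨ μ 1 ≠ 0 := by
    by_contra h
    push Not at h
    apply hμ
    funext j
    fin_cases j
    · exact h.1
    · exact h.2
  by_cases hb : μ 1 = 0
  · -- only the address row: every coordinate counts
    have ha : μ 0 ≠ 0 := hμ01.resolve_right (fun h => h hb)
    have hall : (univ.filter fun i : Fin n => ¬ combW μ (rowsF t (fun _ : Fin 1 => g)) i = 0) = univ := by
      refine filter_true_of_mem fun i _ => ?_
      rw [hcomb i, hb, zero_mul, add_zero]
      exact mul_ne_zero ha (hrowA i)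
    rw [hall, card_univ, Fintype.card_fin]
    omega
  · by_cases ha : μ 0 = 0
    · -- only the gap row: the window counts
      have hsub : (univ.filter fun i : Fin n => lo ≤ i.val ∧ i.val < hi)
          ⊆ univ.filter fun i : Fin n => ¬ combW μ (rowsF t (fun _ : Fin 1 => g)) i = 0 := by
        intro i hi'
        rw [mem_filter] at hi' ⊢
        refine ⟨mem_univ _, ?_⟩
        rw [hcomb i, ha, zero_mul, zero_add]
        unfold rowG
        rw [if_pos hi'.2, mul_one]
        exact hb
      have := card_le_card hsub
      rw [card_window hhin] at this
      omega
    · -- both rows: the complement of the window counts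
      have hsub : (univ.filter fun i : Fin n => ¬ (lo ≤ i.val ∧ i.val < hi))
          ⊆ univ.filter fun i : Fin n => ¬ combW μ (rowsF t (fun _ : Fin 1 => g)) i = 0 := by
        intro i hi'
        rw [mem_filter] at hi' ⊢
        refine ⟨mem_univ _, ?_⟩
        rw [hcomb i]
        unfold rowG
        rw [if_neg hi'.2, mul_zero, add_zero]
        exact mul_ne_zero ha (hrowA i)
      have hc := card_le_card hsub
      have hcompl : (univ.filter fun i : Fin n => ¬ (lo ≤ i.val ∧ i.val < hi)).card = n - (hi - lo) := by
        have h := card_filter_add_card_filter_not (s := (univ : Finset (Fin n))) (p := fun i : Fin n => lo ≤ i.val ∧ i.val < hi)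
        rw [card_window hhin, card_univ, Fintype.card_fin] at h
        omega
      rw [hcompl] at hc
      omega

/-! ### §17' the law at explicit smallness -/

/-- **THE FAR FLIP LAW AT EXPLICIT SMALLNESS** (one `n`): if `128·3^K·4^w·p^{K+2}·n^{K+1}·cos(π/(3p))^L ≤ 1` then a `log₂ n`-junta
presentation whose strategy meets `FarFlipHyp p K w L` wins on at most `(1 − 1/(48p))·2ⁿ` inputs, for every residue `c`. -/
theorem farFlip_bound (hp3 : p ≠ 3) (K w L : ℕ) {n : ℕ} (hn1 : 1 ≤ n)
    (hsmall : 128 * (3 : ℝ) ^ K * (4 : ℝ) ^ w * (p : ℝ) ^ (K + 2) * (n : ℝ) ^ (K + 1) * Real.cos (Real.pi / (3 * p)) ^ L ≤ 1)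
    (c : ℕ) (D : JLinPeel.JLinData p n) (hJ : ∀ g, (D.J g).card ≤ Nat.log 2 n)
    (hT : TowerDefs.FarFlipHyp p K w L D.strat) :
    ((univ.filter fun u : Fin n → Bool => ringWinU c D.strat u = true).card : ℝ) ≤ (1 - 1 / (48 * p)) * (2 : ℝ) ^ n := by
  have hp1 : 1 ≤ p := hp.out.one_lt.le
  obtain ⟨s, t, hst, R, hRK, m, hmK, far, hI, hnear, hS, hrich⟩ := hT
  rw [flipAny_eq'] at hrich  -- part K's `rfl` junction, cited by name (gate dedup)
  have hE := engineFar hp3 c D s t hst (insert (cut t) R) (mem_insert_self _ _) far w L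
    (fun g hg hfar => by
      rcases mem_insert.1 hg with h | h
      · rw [h, cut_val]; omega
      · exact hnear g h hfar)
    hI (fun g hg u hne => hS g (fun h => hg (mem_insert_of_mem h)) u hne)
  obtain ⟨hc0, hc1⟩ := cos_facts hp1
  have hpR : (1 : ℝ) ≤ p := by exact_mod_cast hp1
  -- sizes
  have hR' : (insert (cut t) R).card ≤ K + 1 := (card_insert_le _ _).trans (by omega)
  have hsumJ : ∑ g ∈ insert (cut t) R, (D.J g).card ≤ (K + 1) * Nat.log 2 n := by
    refine (sum_le_card_nsmul _ _ _ fun g _ => hJ g).trans ?_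
    rw [smul_eq_mul]
    exact Nat.mul_le_mul_right _ hR'
  have h2J : (2 : ℝ) ^ (∑ g ∈ insert (cut t) R, (D.J g).card) ≤ (n : ℝ) ^ (K + 1) := by
    have h1 : 2 ^ (∑ g ∈ insert (cut t) R, (D.J g).card) ≤ 2 ^ ((K + 1) * Nat.log 2 n) :=
      Nat.pow_le_pow_right (by norm_num) hsumJ
    have h2 : 2 ^ ((K + 1) * Nat.log 2 n) ≤ n ^ (K + 1) := by
      rw [mul_comm, pow_mul]
      exact Nat.pow_le_pow_left (Nat.pow_log_le_self 2 (by omega)) _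
    exact_mod_cast h1.trans h2
  have h2Jw : (2 : ℝ) ^ ((∑ g ∈ insert (cut t) R, (D.J g).card) + 2 * w) ≤ (n : ℝ) ^ (K + 1) * (4 : ℝ) ^ w := by
    rw [pow_add, pow_mul, show ((2 : ℝ) ^ 2) = 4 by norm_num]
    exact mul_le_mul_of_nonneg_right h2J (pow_nonneg (by norm_num) w)
  have hpG : (p : ℝ) ^ (insert (cut t) R).card ≤ (p : ℝ) ^ (K + 1) := pow_le_pow_right₀ hpR hR'
  have h3m : (3 : ℝ) ^ m ≤ (3 : ℝ) ^ K := pow_le_pow_right₀ (by norm_num) hmK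
  -- the richness, in ℝ
  have hRich : (2 : ℝ) ^ n ≤ 4 * p * ((flipAny D.strat s t).card : ℝ) := by exact_mod_cast hrich
  -- the error term
  have hcL : 0 ≤ Real.cos (Real.pi / (3 * p)) ^ L := pow_nonneg hc0 L
  have herr : 16 * (3 : ℝ) ^ m * (p : ℝ) ^ (insert (cut t) R).card *
      (2 : ℝ) ^ ((∑ g ∈ insert (cut t) R, (D.J g).card) + 2 * w) * (2 : ℝ) ^ n * Real.cos (Real.pi / (3 * p)) ^ L
        ≤ (2 : ℝ) ^ n / (8 * p) := by
    rw [le_div_iff₀ (by positivity)]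
    have hA : (3 : ℝ) ^ m * ((p : ℝ) ^ (insert (cut t) R).card *
        (2 : ℝ) ^ ((∑ g ∈ insert (cut t) R, (D.J g).card) + 2 * w))
        ≤ (3 : ℝ) ^ K * ((p : ℝ) ^ (K + 1) * ((n : ℝ) ^ (K + 1) * (4 : ℝ) ^ w)) :=
      mul_le_mul h3m (mul_le_mul hpG h2Jw (by positivity) (by positivity)) (by positivity) (by positivity)
    have h3 : (0 : ℝ) ≤ 2 ^ n := by positivity
    calc 16 * (3 : ℝ) ^ m * (p : ℝ) ^ (insert (cut t) R).card *
          (2 : ℝ) ^ ((∑ g ∈ insert (cut t) R, (D.J g).card) + 2 * w) * (2 : ℝ) ^ n * Real.cos (Real.pi / (3 * p)) ^ L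
            * (8 * p)
        = 128 * (p : ℝ) * ((3 : ℝ) ^ m * ((p : ℝ) ^ (insert (cut t) R).card *
            (2 : ℝ) ^ ((∑ g ∈ insert (cut t) R, (D.J g).card) + 2 * w))) * Real.cos (Real.pi / (3 * p)) ^ L * 2 ^ n := by
          ring
      _ ≤ 128 * (p : ℝ) * ((3 : ℝ) ^ K * ((p : ℝ) ^ (K + 1) * ((n : ℝ) ^ (K + 1) * (4 : ℝ) ^ w)))
            * Real.cos (Real.pi / (3 * p)) ^ L * 2 ^ n := by
          gcongr
      _ = (128 * (3 : ℝ) ^ K * (4 : ℝ) ^ w * (p : ℝ) ^ (K + 2) * (n : ℝ) ^ (K + 1) * Real.cos (Real.pi / (3 * p)) ^ L)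
            * 2 ^ n := by
          ring
      _ ≤ 1 * 2 ^ n := mul_le_mul_of_nonneg_right hsmall h3
      _ = (2 : ℝ) ^ n := one_mul _
  have hp0 : (0 : ℝ) < p := by linarith
  have key : 6 * ((univ.filter fun u : Fin n → Bool => ringWinU c D.strat u = true).card : ℝ)
      ≤ 6 * (2 : ℝ) ^ n - (2 : ℝ) ^ n / (4 * p) + (2 : ℝ) ^ n / (8 * p) := by
    have h4 : (2 : ℝ) ^ n / (4 * p) ≤ ((flipAny D.strat s t).card : ℝ) := by
      rw [div_le_iff₀ (by positivity)]; linarith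
    linarith
  have h5 : 6 * (2 : ℝ) ^ n - (2 : ℝ) ^ n / (4 * p) + (2 : ℝ) ^ n / (8 * p) = 6 * ((1 - 1 / (48 * p)) * (2 : ℝ) ^ n) := by
    field_simp; ring
  linarith

/-! ### §17'' the log-budget schedule -/

omit hp in
/-- the core eventuality: `B^{(ℓ+1)²}·a^{ℓ³} ≤ 1` for `ℓ` large (`B ≥ 1`, `0 ≤ a < 1`). -/
theorem eventually_cube_beats_square (B a : ℝ) (hB : 1 ≤ B) (ha0 : 0 ≤ a) (ha1 : a < 1) :
    ∃ ℓ₀ : ℕ, ∀ ℓ ≥ ℓ₀, B ^ ((ℓ + 1) ^ 2) * a ^ (ℓ ^ 3) ≤ 1 := by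
  have hB0 : 0 < B := by linarith
  obtain ⟨j, hj⟩ := exists_pow_lt_of_lt_one (x := 1 / B) (by positivity) ha1
  have hj' : B * a ^ j < 1 := by
    have := mul_lt_mul_of_pos_left hj hB0
    rwa [mul_one_div_cancel hB0.ne'] at this
  refine ⟨4 * j + 1, fun ℓ hℓ => ?_⟩
  have hexp : j * (ℓ + 1) ^ 2 ≤ ℓ ^ 3 := by
    have h1 : (ℓ + 1) ^ 2 ≤ 4 * ℓ ^ 2 := by nlinarith
    calc j * (ℓ + 1) ^ 2 ≤ j * (4 * ℓ ^ 2) := Nat.mul_le_mul_left _ h1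
      _ = (4 * j) * ℓ ^ 2 := by ring
      _ ≤ ℓ * ℓ ^ 2 := Nat.mul_le_mul_right _ (by omega)
      _ = ℓ ^ 3 := by ring
  have ha_le : a ^ (ℓ ^ 3) ≤ a ^ (j * (ℓ + 1) ^ 2) := pow_le_pow_of_le_one ha0 ha1.le hexp
  calc B ^ ((ℓ + 1) ^ 2) * a ^ (ℓ ^ 3) ≤ B ^ ((ℓ + 1) ^ 2) * a ^ (j * (ℓ + 1) ^ 2) :=
        mul_le_mul_of_nonneg_left ha_le (by positivity)
    _ = (B * a ^ j) ^ ((ℓ + 1) ^ 2) := by rw [mul_pow, ← pow_mul]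
    _ ≤ 1 := pow_le_one₀ (by positivity) hj'.le

omit hp in
/-- the error schedule of the log-budget far dial: `128·3^{dialB n}·4^{dialB n}·p^{dialB n + 2}·n^{dialB n + 1}·cos(π/(3p))^{(log₂ n)³} ≤ 1`
eventually (every factor is at most `C^{(log₂ n + 1)²}`). -/
theorem eventually_smallFar (p : ℕ) (hp2 : 2 ≤ p) : ∃ n₀ : ℕ, ∀ n ≥ n₀,
    128 * (3 : ℝ) ^ TowerDefs.dialB n * (4 : ℝ) ^ TowerDefs.dialB n * (p : ℝ) ^ (TowerDefs.dialB n + 2)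
      * (n : ℝ) ^ (TowerDefs.dialB n + 1) * Real.cos (Real.pi / (3 * p)) ^ TowerDefs.farL n ≤ 1 := by
  have hp1 : 1 ≤ p := by omega
  obtain ⟨hc0, hc1⟩ := cos_facts hp1
  have hpR : (1 : ℝ) ≤ p := by exact_mod_cast hp1
  set B : ℝ := 128 * 81 * 256 * (p : ℝ) ^ 6 * 32 with hBdef
  have hB1 : 1 ≤ B := by
    rw [hBdef]
    have : (1 : ℝ) ≤ (p : ℝ) ^ 6 := one_le_pow₀ hpR
    nlinarith
  obtain ⟨ℓ₀, hℓ₀⟩ := eventually_cube_beats_square B _ hB1 hc0 hc1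
  refine ⟨2 ^ ℓ₀, fun n hn => ?_⟩
  have hn1 : 1 ≤ n := le_trans Nat.one_le_two_pow hn
  set ℓ := Nat.log 2 n with hℓdef
  have hℓ : ℓ₀ ≤ ℓ := by rw [hℓdef]; exact Nat.le_log_of_pow_le (by norm_num) hn
  have hnlt : n < 2 ^ (ℓ + 1) := by rw [hℓdef]; exact Nat.lt_pow_succ_log_self (by norm_num) n
  have hnR : (n : ℝ) ≤ (2 : ℝ) ^ (ℓ + 1) := by exact_mod_cast hnlt.le
  have hdB : TowerDefs.dialB n = 4 * (ℓ + 1) := by unfold TowerDefs.dialB; rw [hℓdef]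
  have hfL : TowerDefs.farL n = ℓ ^ 3 := by unfold TowerDefs.farL; rw [hℓdef]
  rw [hdB, hfL]
  have hsq : ℓ + 1 ≤ (ℓ + 1) ^ 2 := by nlinarith
  have hsq0 : (ℓ + 1) ^ 2 ≠ 0 := by positivity
  -- each factor is at most `C^{(ℓ+1)²}`
  have f1 : (128 : ℝ) ≤ 128 ^ ((ℓ + 1) ^ 2) := le_self_pow₀ (by norm_num) hsq0
  have f2 : (3 : ℝ) ^ (4 * (ℓ + 1)) ≤ 81 ^ ((ℓ + 1) ^ 2) := by
    rw [pow_mul, show ((3 : ℝ) ^ 4) = 81 by norm_num]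
    exact pow_le_pow_right₀ (by norm_num) hsq
  have f3 : (4 : ℝ) ^ (4 * (ℓ + 1)) ≤ 256 ^ ((ℓ + 1) ^ 2) := by
    rw [pow_mul, show ((4 : ℝ) ^ 4) = 256 by norm_num]
    exact pow_le_pow_right₀ (by norm_num) hsq
  have f4 : (p : ℝ) ^ (4 * (ℓ + 1) + 2) ≤ ((p : ℝ) ^ 6) ^ ((ℓ + 1) ^ 2) := by
    rw [← pow_mul]
    exact pow_le_pow_right₀ hpR (by nlinarith)
  have f5 : (n : ℝ) ^ (4 * (ℓ + 1) + 1) ≤ 32 ^ ((ℓ + 1) ^ 2) := by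
    calc (n : ℝ) ^ (4 * (ℓ + 1) + 1) ≤ ((2 : ℝ) ^ (ℓ + 1)) ^ (4 * (ℓ + 1) + 1) :=
          pow_le_pow_left₀ (by positivity) hnR _
      _ ≤ ((2 : ℝ) ^ (ℓ + 1)) ^ (5 * (ℓ + 1)) := pow_le_pow_right₀ (one_le_pow₀ (by norm_num)) (by omega)
      _ = 32 ^ ((ℓ + 1) ^ 2) := by
          rw [← pow_mul, show (ℓ + 1) * (5 * (ℓ + 1)) = 5 * (ℓ + 1) ^ 2 by ring, pow_mul]
          norm_num
  have hcL : 0 ≤ Real.cos (Real.pi / (3 * p)) ^ (ℓ ^ 3) := pow_nonneg hc0 _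
  calc 128 * (3 : ℝ) ^ (4 * (ℓ + 1)) * (4 : ℝ) ^ (4 * (ℓ + 1)) * (p : ℝ) ^ (4 * (ℓ + 1) + 2)
        * (n : ℝ) ^ (4 * (ℓ + 1) + 1) * Real.cos (Real.pi / (3 * p)) ^ (ℓ ^ 3)
      ≤ 128 ^ ((ℓ + 1) ^ 2) * 81 ^ ((ℓ + 1) ^ 2) * 256 ^ ((ℓ + 1) ^ 2) * ((p : ℝ) ^ 6) ^ ((ℓ + 1) ^ 2)
        * 32 ^ ((ℓ + 1) ^ 2) * Real.cos (Real.pi / (3 * p)) ^ (ℓ ^ 3) := by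
        gcongr
    _ = B ^ ((ℓ + 1) ^ 2) * Real.cos (Real.pi / (3 * p)) ^ (ℓ ^ 3) := by
        rw [hBdef, mul_pow, mul_pow, mul_pow, mul_pow]
    _ ≤ 1 := hℓ₀ ℓ hℓ

/-- ★ **THE FAR-READER FLIP DIAL AT LOGARITHMIC BUDGET (tenth decided dial).** for every prime `p ≠ 3`, eventually in `n`:
a `log₂ n`-junta ⊕ form presentation whose strategy meets `FarFlipHyp p (dialB n) (dialB n) (farL n)` — some adjacent pair with at
most `4(log₂ n + 1)` non-swap-stable cuts, the far ones (any number of them) through gaps independent of the address at level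
`(log₂ n)³`, the others within `4(log₂ n + 1)` of the pair, and `#flipAny ≥ 2ⁿ/(4p)` — wins on at most `(1 − 1/(48p))·2ⁿ` inputs,
for every residue `c`. -/
theorem farFlip_hard_log (hp3 : p ≠ 3) : ∃ n₀ : ℕ, ∀ n ≥ n₀, ∀ (c : ℕ) (D : JLinPeel.JLinData p n),
    (∀ g, (D.J g).card ≤ Nat.log 2 n) →
      TowerDefs.FarFlipHyp p (TowerDefs.dialB n) (TowerDefs.dialB n) (TowerDefs.farL n) D.strat →
      ((univ.filter fun u : Fin n → Bool => ringWinU c D.strat u = true).card : ℝ)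
        ≤ (1 - 1 / (48 * p)) * (2 : ℝ) ^ n := by
  obtain ⟨n₀, hn₀⟩ := eventually_smallFar p hp.out.two_le
  refine ⟨max n₀ 1, fun n hn c D hJ hT => ?_⟩
  exact farFlip_bound hp3 (TowerDefs.dialB n) (TowerDefs.dialB n) (TowerDefs.farL n) (le_trans (le_max_right _ _) hn)
    (hn₀ n (le_trans (le_max_left _ _) hn)) c D hJ hT

end FarDial

end TokenDial

end Summit.QuantumAdvantage.AdviceFreeQNC0.JLinPeel
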